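import Summits.CriticalPhenomena.PercolationContinuityZ3.Theorems.Transplant.PlanarSkeletonFrmFromDefs
import Summits.CriticalPhenomena.PercolationContinuityZ3.Theorems.Transplant.SkelFrmFromBChoiceWindow
import Summits.CriticalPhenomena.PercolationContinuityZ3.Theorems.Transplant.SkelFrmBChoiceWindow
import Summits.CriticalPhenomena.PercolationContinuityZ3.Theorems.Transplant.SkelPhiCorridorKGBoxes
import HarnessLib
import Summits.CriticalPhenomena.PercolationContinuityZ3.Theorems.Transplant.SkelFrmBChoiceReadNums
/-!
# U-WAVE PORT (RULING D-U, lead g21 2026-08-26; WAVE-U-MANIFEST v3.0 row «SkelFrmBChoiceReadNums» ↦ «SkelFrmFromBChoiceReadNums») of the tree module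
# `Transplant/SkelFrmBChoiceReadNums` onto the carrier `PlanarSkeletonFrmFrom` (frames only, cylinders connected from width `ℓ₀` on)

ORIGINAL TITLE: N2 (frames-only node `SamePDropOfSkeletonFrm₁`, OPEN) — (ζ″) ledger, THE NUMBERS BEHIND THE (C) READING ROWS: at the tuple of record

builds on p205010 (kernel theorem, internal audit signed; external expert review pending) — nothing in this file uses p205010; NOTHING is claimed about the
OPEN node U `SamePDropOfSkeletonFrmFrom₁` (nor U_s / the end state).  Lane `prim-bschramm`, seat `prim-hp-8 gen 53 (U-wave port pen, family P-hp8; tool of record = p3-g26 port_u.py)`; helper file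
(`--supports stmt-CriticalPhenomena-4575 --as helper`).  PORT RULES r1–r4 of RULING D-U: declaration order and proof texts are those of the original,
byte-identical except (i) the carrier token `PlanarSkeletonFrm ↦ PlanarSkeletonFrmFrom` (binders, `namespace`/`end` lines, qualified names of twinned
declarations), (ii) carrier-FREE declarations of the original (φ-level `Skelφ…` blocks and namespace-only arithmetic residents) are NOT re-declared —
this file imports the original and `export`s the twin-free residents (POLICY T / treatment (m1)); residents whose statement mentions a twinned
constant are copied, (iii) every carrier-binding declaration keeps its explicit binder `(Φ : PlanarSkeletonFrmFrom G)` in its own signature (r2).  Docstrings and citations are the original's.  Manifest row idx 69 (level 11; flags verbatim|MIXED(m1)); filed by the hp-8 lineage under RULING M-11 (family P-hp8).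
-/

open scoped Classical

noncomputable section

namespace Summit.CriticalPhenomena.PercolationContinuityZ3.Theorems.Transplant

namespace Skelφ

/-! ## §1 Generic: `Z₀` as `X + R′ + 2n`, and a closed bound on `Z₁` -/

section BoxesGeneric

variable {n ℓ : ℕ} {hs v : ℤ} {R' ρ q W : ℕ}

end BoxesGeneric

end Skelφ

/-! ## §2 At the tuple of record -/

namespace PlanarSkeletonFrmFrom

namespace NegB

open Literature.Probability.Percolation Literature.Probability.LatticeModels SimpleGraph
open SkelConc (Consts)
open Skelφ (shearUnit kgSL kgΔ kgN kgFar kgX kgX₂ kgM₁ kgM₂ kgWm₂ kgWp₂ kgZ₀ kgZ₁ KGRows)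
open TwoAxis.Para (modulus)
open Neg

section Vals

variable (κ : Consts) {V : Type} [DecidableEq V] [Countable V] {G : SimpleGraph V} [G.LocallyFinite] (Φ : PlanarSkeletonFrmFrom G) (t : V) (p : unitInterval)
  (D : Skelφ.StepI.DataNS V) (g f mk : ℕ)

/-- **The floor consequences at the tuple of record**: `40K·R′0 + 1 ≤ n_L`, `40K·R′0 ≤ sL + 1`, `958 ≤ sL`, `1 ≤ R′0`, `40 ≤ K`, `8R′0 + 7 ≤ n_L`. [folklore] -/
theorem valsQ_floor (κ : Consts) {V : Type} [DecidableEq V] [Countable V] {G : SimpleGraph V} [G.LocallyFinite] (Φ : PlanarSkeletonFrmFrom G) (t : V) (p : unitInterval) (D : Skelφ.StepI.DataNS V) (g : ℕ) (f : ℕ) (mk : ℕ) (hN : EqNumL κ Φ t p D g f) (hg : gFloorKG κ Φ t p D mk ≤ g) (hg2 : 40 * Neg.K κ * KS0.R'0 κ Φ t p D mk ≤ g) :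
    40 * (Neg.K κ : ℤ) * (KS0.R'0 κ Φ t p D mk : ℕ) + 1 ≤ (nL κ Φ t p D g f : ℤ) ∧
    40 * (Neg.K κ : ℤ) * (KS0.R'0 κ Φ t p D mk : ℕ) ≤ kgSL (nL κ Φ t p D g f) (ℓL κ Φ t p D g f) (hL κ Φ t p D g f) + 1 ∧
    958 ≤ kgSL (nL κ Φ t p D g f) (ℓL κ Φ t p D g f) (hL κ Φ t p D g f) ∧
    (1 : ℤ) ≤ (KS0.R'0 κ Φ t p D mk : ℕ) ∧ (40 : ℤ) ≤ Neg.K κ ∧ 8 * ((KS0.R'0 κ Φ t p D mk : ℕ) : ℤ) + 7 ≤ (nL κ Φ t p D g f : ℤ) := by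
  have hnle := hN.n_le
  have hgML : g ≤ ML κ Φ t p D g := (ML_le_ML κ Φ t p D g).2
  have hsL := ML_sub_one_le_kgSL κ Φ t p D g f hN
  have h960 := slack_floor_le_ML κ Φ t p D g
  have hM : (959 : ℤ) ≤ ML κ Φ t p D g := by
    have : 959 ≤ ML κ Φ t p D g := by omega
    exact_mod_cast this
  unfold gFloorKG at hg
  have hfl : ((8 * KS0.R'0 κ Φ t p D mk + 3 * Mu D + 6 : ℕ) : ℤ) ≤ ML κ Φ t p D g := by exact_mod_cast hg.trans hgML
  have hfl2 : ((40 * Neg.K κ * KS0.R'0 κ Φ t p D mk : ℕ) : ℤ) ≤ ML κ Φ t p D g := by exact_mod_cast hg2.trans hgML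
  push_cast at hfl hfl2
  have hR := (KS0.T0_lt_R'0 κ Φ t p D mk).2.2.2
  have hR' : (1 : ℤ) ≤ (KS0.R'0 κ Φ t p D mk : ℕ) := by exact_mod_cast hR
  have hK : (40 : ℤ) ≤ Neg.K κ := by exact_mod_cast (Neg.forty_le_K κ).1
  have hM0 : (0 : ℤ) ≤ (Mu D : ℤ) := by positivity
  refine ⟨by linarith, by linarith, by linarith, hR', hK, by linarith⟩

/-- `kgW WxQ = 9·sL + 19` (as an integer) and `kgq qxQ = 41·n_L`. [folklore] -/
theorem kgW_WxQ_eq (κ : Consts) {V : Type} [DecidableEq V] [Countable V] {G : SimpleGraph V} [G.LocallyFinite] (Φ : PlanarSkeletonFrmFrom G) (t : V) (p : unitInterval) (D : Skelφ.StepI.DataNS V) (g : ℕ) (f : ℕ) (hN : EqNumL κ Φ t p D g f) :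
    ((kgW κ Φ t p D g f (WxQ κ Φ t p D g f) : ℕ) : ℤ) = 9 * kgSL (nL κ Φ t p D g f) (ℓL κ Φ t p D g f) (hL κ Φ t p D g f) + 19 ∧
    ((kgq κ Φ t p D g f (qxQ κ Φ t p D g f) : ℕ) : ℤ) = 41 * (nL κ Φ t p D g f : ℤ) := by
  have hsL := ML_sub_one_le_kgSL κ Φ t p D g f hN
  have h960 := slack_floor_le_ML κ Φ t p D g
  have hM : (959 : ℤ) ≤ ML κ Φ t p D g := by
    have : 959 ≤ ML κ Φ t p D g := by omega
    exact_mod_cast this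
  have hs0 : 0 ≤ kgSL (nL κ Φ t p D g f) (ℓL κ Φ t p D g f) (hL κ Φ t p D g f) := by linarith
  constructor
  · unfold kgW WxQ; push_cast; rw [Int.toNat_of_nonneg hs0, Int.toNat_of_nonneg (by linarith)]; ring
  · unfold kgq qxQ; push_cast; ring

/-- **`m₁ + 1 ≤ 29`** at the tuple of record (`2sL(m₁+1) ≤ 6W + 6(N+1)R′ ≤ 58sL + 117`). [this work] -/
theorem m₁Q_le (κ : Consts) {V : Type} [DecidableEq V] [Countable V] {G : SimpleGraph V} [G.LocallyFinite] (Φ : PlanarSkeletonFrmFrom G) (t : V) (p : unitInterval) (D : Skelφ.StepI.DataNS V) (g : ℕ) (f : ℕ) (mk : ℕ) (hN : EqNumL κ Φ t p D g f) (hg : gFloorKG κ Φ t p D mk ≤ g) (hg2 : 40 * Neg.K κ * KS0.R'0 κ Φ t p D mk ≤ g) :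
    (((kgM₁ (nL κ Φ t p D g f) (ℓL κ Φ t p D g f) (hL κ Φ t p D g f) (kgR κ Φ t p D mk) 0 (kgW κ Φ t p D g f (WxQ κ Φ t p D g f))
      (kgNv0 κ Φ t p D g f mk (qxQ κ Φ t p D g f) (WxQ κ Φ t p D g f)) : ℕ) : ℤ)) + 1 ≤ 29 := by
  have H := kgRows0_of κ Φ t p D g f mk (qxQ κ Φ t p D g f) (WxQ κ Φ t p D g f) hN hg
  obtain ⟨hn40, hs40, hbig, hR1, hK, -⟩ := valsQ_floor κ Φ t p D g f mk hN hg hg2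
  obtain ⟨hS, -, -, -, -⟩ := kg_floors κ Φ t p D g f mk (WxQ κ Φ t p D g f) hN hg (kgRes_Q κ Φ t p D g f hN).hWx
  have hb := H.kgM₁_budget hS (kgNv0 κ Φ t p D g f mk (qxQ κ Φ t p D g f) (WxQ κ Φ t p D g f))
  have hNle : ((kgNv0 κ Φ t p D g f mk (qxQ κ Φ t p D g f) (WxQ κ Φ t p D g f) : ℕ) : ℤ) ≤ 20 * (Neg.K κ : ℤ) + 4 := by
    exact_mod_cast kgNv0_le κ Φ t p D g f mk (qxQ κ Φ t p D g f) (WxQ κ Φ t p D g f) hN hg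
  obtain ⟨hW, -⟩ := kgW_WxQ_eq κ Φ t p D g f hN
  unfold Skelφ.kgT₁ at hb
  rw [hW] at hb
  unfold kgR at hb ⊢
  set a := (((kgM₁ (nL κ Φ t p D g f) (ℓL κ Φ t p D g f) (hL κ Φ t p D g f) (KS0.R'0 κ Φ t p D mk) 0 (kgW κ Φ t p D g f (WxQ κ Φ t p D g f))
      (kgNv0 κ Φ t p D g f mk (qxQ κ Φ t p D g f) (WxQ κ Φ t p D g f)) : ℕ) : ℤ)) + 1 with ha
  set s := kgSL (nL κ Φ t p D g f) (ℓL κ Φ t p D g f) (hL κ Φ t p D g f) with hs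
  set R := ((KS0.R'0 κ Φ t p D mk : ℕ) : ℤ) with hRdef
  set Nn := ((kgNv0 κ Φ t p D g f mk (qxQ κ Φ t p D g f) (WxQ κ Φ t p D g f) : ℕ) : ℤ) with hNn
  -- 2 s a ≤ 54 s + 114 + 6 (N+1) R and 6(N+1)R ≤ 4 s + 3
  have h1 : 6 * ((Nn + 1) * R) ≤ 4 * s + 3 := by
    have : (Nn + 1) * R ≤ (20 * (Neg.K κ : ℤ) + 5) * R := mul_le_mul_of_nonneg_right (by linarith) (by linarith)
    nlinarith
  have h2 : 2 * s * a ≤ 58 * s + 117 := by nlinarith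
  have h3 : 2 * s * a < 2 * s * 30 := by linarith
  have := lt_of_mul_lt_mul_left h3 (by linarith)
  linarith

/-- **`X₂ ≤ 71·n_L`** at the tuple of record (`41n + (20K+5)R′ + 29(R′ + n)`, `34R′ ≤ n/… `). [this work] -/
theorem X₂Q_le (κ : Consts) {V : Type} [DecidableEq V] [Countable V] {G : SimpleGraph V} [G.LocallyFinite] (Φ : PlanarSkeletonFrmFrom G) (t : V) (p : unitInterval) (D : Skelφ.StepI.DataNS V) (g : ℕ) (f : ℕ) (mk : ℕ) (hN : EqNumL κ Φ t p D g f) (hg : gFloorKG κ Φ t p D mk ≤ g) (hg2 : 40 * Neg.K κ * KS0.R'0 κ Φ t p D mk ≤ g) :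
    kgX₂ (nL κ Φ t p D g f) (ℓL κ Φ t p D g f) (hL κ Φ t p D g f) (vL κ Φ t p D g f) (kgR κ Φ t p D mk) 0 (kgq κ Φ t p D g f (qxQ κ Φ t p D g f))
      (kgW κ Φ t p D g f (WxQ κ Φ t p D g f)) (kgNv0 κ Φ t p D g f mk (qxQ κ Φ t p D g f) (WxQ κ Φ t p D g f)) ≤ 71 * (nL κ Φ t p D g f : ℤ) := by
  have ha := m₁Q_le κ Φ t p D g f mk hN hg hg2
  obtain ⟨hn40, -, -, hR1, hK, h8⟩ := valsQ_floor κ Φ t p D g f mk hN hg hg2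
  have hNle : ((kgNv0 κ Φ t p D g f mk (qxQ κ Φ t p D g f) (WxQ κ Φ t p D g f) : ℕ) : ℤ) ≤ 20 * (Neg.K κ : ℤ) + 4 := by
    exact_mod_cast kgNv0_le κ Φ t p D g f mk (qxQ κ Φ t p D g f) (WxQ κ Φ t p D g f) hN hg
  obtain ⟨-, hq⟩ := kgW_WxQ_eq κ Φ t p D g f hN
  have hv := hN.v_le
  have hva : (0 : ℤ) ≤ |vL κ Φ t p D g f| := abs_nonneg _
  unfold Skelφ.kgX₂
  rw [hq]
  unfold kgR at ha ⊢
  set a := (((kgM₁ (nL κ Φ t p D g f) (ℓL κ Φ t p D g f) (hL κ Φ t p D g f) (KS0.R'0 κ Φ t p D mk) 0 (kgW κ Φ t p D g f (WxQ κ Φ t p D g f))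
      (kgNv0 κ Φ t p D g f mk (qxQ κ Φ t p D g f) (WxQ κ Φ t p D g f)) : ℕ) : ℤ)) + 1 with hadef
  set R := ((KS0.R'0 κ Φ t p D mk : ℕ) : ℤ) with hRdef
  set Nn := ((kgNv0 κ Φ t p D g f mk (qxQ κ Φ t p D g f) (WxQ κ Φ t p D g f) : ℕ) : ℤ) with hNn
  set n := (nL κ Φ t p D g f : ℤ) with hndef
  have ha0 : 0 ≤ a := by positivity
  have h1 : (Nn + 1) * R ≤ (20 * (Neg.K κ : ℤ) + 5) * R := mul_le_mul_of_nonneg_right (by linarith) (by linarith)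
  have h2 : a * (R + ((0 : ℕ) : ℤ) + |vL κ Φ t p D g f|) ≤ 29 * (R + n) := by
    have : R + ((0 : ℕ) : ℤ) + |vL κ Φ t p D g f| ≤ R + n := by push_cast; linarith
    calc a * (R + ((0 : ℕ) : ℤ) + |vL κ Φ t p D g f|) ≤ a * (R + n) := mul_le_mul_of_nonneg_left this ha0
      _ ≤ 29 * (R + n) := mul_le_mul_of_nonneg_right ha (by linarith)
  push_cast at h2 ⊢
  nlinarith

/-- **`m₂ + 1 ≤ 213`** at the tuple of record (`2n(m₂+1) ≤ 6X₂ + 3 ≤ 426n + 3`). [this work] -/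
theorem m₂Q_le (κ : Consts) {V : Type} [DecidableEq V] [Countable V] {G : SimpleGraph V} [G.LocallyFinite] (Φ : PlanarSkeletonFrmFrom G) (t : V) (p : unitInterval) (D : Skelφ.StepI.DataNS V) (g : ℕ) (f : ℕ) (mk : ℕ) (hN : EqNumL κ Φ t p D g f) (hg : gFloorKG κ Φ t p D mk ≤ g) (hg2 : 40 * Neg.K κ * KS0.R'0 κ Φ t p D mk ≤ g) :
    (((kgM₂ (nL κ Φ t p D g f) (ℓL κ Φ t p D g f) (hL κ Φ t p D g f) (vL κ Φ t p D g f) (kgR κ Φ t p D mk) 0 (kgq κ Φ t p D g f (qxQ κ Φ t p D g f))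
      (kgW κ Φ t p D g f (WxQ κ Φ t p D g f)) (kgNv0 κ Φ t p D g f mk (qxQ κ Φ t p D g f) (WxQ κ Φ t p D g f)) : ℕ) : ℤ)) + 1 ≤ 213 := by
  have H := kgRows0_of κ Φ t p D g f mk (qxQ κ Φ t p D g f) (WxQ κ Φ t p D g f) hN hg
  have hX := X₂Q_le κ Φ t p D g f mk hN hg hg2
  obtain ⟨-, hSn, -, -, -⟩ := kg_floors κ Φ t p D g f mk (WxQ κ Φ t p D g f) hN hg (kgRes_Q κ Φ t p D g f hN).hWx
  have hb := H.kgM₂_succ_budget hSn (kgNv0 κ Φ t p D g f mk (qxQ κ Φ t p D g f) (WxQ κ Φ t p D g f))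
  obtain ⟨-, -, -, hR1, -, h8⟩ := valsQ_floor κ Φ t p D g f mk hN hg hg2
  set b := (((kgM₂ (nL κ Φ t p D g f) (ℓL κ Φ t p D g f) (hL κ Φ t p D g f) (vL κ Φ t p D g f) (kgR κ Φ t p D mk) 0
      (kgq κ Φ t p D g f (qxQ κ Φ t p D g f)) (kgW κ Φ t p D g f (WxQ κ Φ t p D g f)) (kgNv0 κ Φ t p D g f mk (qxQ κ Φ t p D g f) (WxQ κ Φ t p D g f)) : ℕ) : ℤ)) + 1
    with hbdef
  have h3 : 2 * (nL κ Φ t p D g f : ℤ) * b < 2 * (nL κ Φ t p D g f : ℤ) * 214 := by linarith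
  have := lt_of_mul_lt_mul_left h3 (by positivity)
  linarith

/-- **`Z₀ ≤ 144·n_L`** and **`(N+1)·n_L + Z₀ ≤ 20K·n_L + 5·n_L`** at the tuple of record. [this work] -/
theorem Z₀Q_le (κ : Consts) {V : Type} [DecidableEq V] [Countable V] {G : SimpleGraph V} [G.LocallyFinite] (Φ : PlanarSkeletonFrmFrom G) (t : V) (p : unitInterval) (D : Skelφ.StepI.DataNS V) (g : ℕ) (f : ℕ) (mk : ℕ) (hN : EqNumL κ Φ t p D g f) (hg : gFloorKG κ Φ t p D mk ≤ g) (hg2 : 40 * Neg.K κ * KS0.R'0 κ Φ t p D mk ≤ g) :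
    kgZ₀ (nL κ Φ t p D g f) (vL κ Φ t p D g f) (kgR κ Φ t p D mk) 0 (kgq κ Φ t p D g f (qxQ κ Φ t p D g f))
        (kgNv0 κ Φ t p D g f mk (qxQ κ Φ t p D g f) (WxQ κ Φ t p D g f))
        (kgM₁ (nL κ Φ t p D g f) (ℓL κ Φ t p D g f) (hL κ Φ t p D g f) (kgR κ Φ t p D mk) 0 (kgW κ Φ t p D g f (WxQ κ Φ t p D g f))
          (kgNv0 κ Φ t p D g f mk (qxQ κ Φ t p D g f) (WxQ κ Φ t p D g f)))
        (kgM₂ (nL κ Φ t p D g f) (ℓL κ Φ t p D g f) (hL κ Φ t p D g f) (vL κ Φ t p D g f) (kgR κ Φ t p D mk) 0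
          (kgq κ Φ t p D g f (qxQ κ Φ t p D g f)) (kgW κ Φ t p D g f (WxQ κ Φ t p D g f)) (kgNv0 κ Φ t p D g f mk (qxQ κ Φ t p D g f) (WxQ κ Φ t p D g f)))
      ≤ 144 * (nL κ Φ t p D g f : ℤ) ∧
    ((kgNv0 κ Φ t p D g f mk (qxQ κ Φ t p D g f) (WxQ κ Φ t p D g f) : ℕ) + 1 : ℤ) * (nL κ Φ t p D g f : ℤ) +
      kgZ₀ (nL κ Φ t p D g f) (vL κ Φ t p D g f) (kgR κ Φ t p D mk) 0 (kgq κ Φ t p D g f (qxQ κ Φ t p D g f))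
        (kgNv0 κ Φ t p D g f mk (qxQ κ Φ t p D g f) (WxQ κ Φ t p D g f))
        (kgM₁ (nL κ Φ t p D g f) (ℓL κ Φ t p D g f) (hL κ Φ t p D g f) (kgR κ Φ t p D mk) 0 (kgW κ Φ t p D g f (WxQ κ Φ t p D g f))
          (kgNv0 κ Φ t p D g f mk (qxQ κ Φ t p D g f) (WxQ κ Φ t p D g f)))
        (kgM₂ (nL κ Φ t p D g f) (ℓL κ Φ t p D g f) (hL κ Φ t p D g f) (vL κ Φ t p D g f) (kgR κ Φ t p D mk) 0
          (kgq κ Φ t p D g f (qxQ κ Φ t p D g f)) (kgW κ Φ t p D g f (WxQ κ Φ t p D g f)) (kgNv0 κ Φ t p D g f mk (qxQ κ Φ t p D g f) (WxQ κ Φ t p D g f)))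
      ≤ 20 * (Neg.K κ : ℤ) * (nL κ Φ t p D g f : ℤ) + 5 * (nL κ Φ t p D g f : ℤ) := by
  have H := kgRows0_of κ Φ t p D g f mk (qxQ κ Φ t p D g f) (WxQ κ Φ t p D g f) hN hg
  have hX₂ := X₂Q_le κ Φ t p D g f mk hN hg hg2
  obtain ⟨hn40, -, -, hR1, hK, h8⟩ := valsQ_floor κ Φ t p D g f mk hN hg hg2
  obtain ⟨-, -, hS₂, -, -⟩ := kg_floors κ Φ t p D g f mk (WxQ κ Φ t p D g f) hN hg (kgRes_Q κ Φ t p D g f hN).hWx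
  have hX := H.kgX_budget hS₂ (kgNv0 κ Φ t p D g f mk (qxQ κ Φ t p D g f) (WxQ κ Φ t p D g f))
  rw [Skelφ.kgZ₀_eq]
  -- the far edge: kgFar N ≤ tgt0 ≤ 20Kn + 2n + 4R
  have hfar := (H.kgN_spec (kgFar_zero_le_kgTgt0 κ Φ t p D g f mk (qxQ κ Φ t p D g f) (WxQ κ Φ t p D g f) hN hg (kgRes_Q κ Φ t p D g f hN))).1
  have hNv : kgN (nL κ Φ t p D g f) (ℓL κ Φ t p D g f) (hL κ Φ t p D g f) (vL κ Φ t p D g f) (kgR κ Φ t p D mk) 0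
      (kgq κ Φ t p D g f (qxQ κ Φ t p D g f)) (kgW κ Φ t p D g f (WxQ κ Φ t p D g f)) (kgTgt0 κ Φ t p D g f mk) =
      kgNv0 κ Φ t p D g f mk (qxQ κ Φ t p D g f) (WxQ κ Φ t p D g f) := rfl
  rw [hNv] at hfar
  have hv := hN.v_le
  have hva : (0 : ℤ) ≤ |vL κ Φ t p D g f| := abs_nonneg _
  have htgt : kgTgt0 κ Φ t p D g f mk ≤ 20 * (Neg.K κ : ℤ) * (nL κ Φ t p D g f : ℤ) + 2 * (nL κ Φ t p D g f : ℤ) + 4 * ((KS0.R'0 κ Φ t p D mk : ℕ) : ℤ) := by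
    unfold kgTgt0 pitch Skelφ.kgΔ kgR
    have e1 := Int.ediv_mul_le ((nL κ Φ t p D g f : ℤ) - 1) (b := 2) (by norm_num)
    have e2 := Int.ediv_mul_le ((nL κ Φ t p D g f : ℤ) + (8 * ((KS0.R'0 κ Φ t p D mk : ℕ) : ℤ) + 7 * ((0 : ℕ) : ℤ) + |vL κ Φ t p D g f|)) (b := 2)
      (by norm_num)
    push_cast at e1 e2 ⊢
    linarith
  unfold Skelφ.kgFar at hfar
  unfold kgR at hX hX₂ hfar ⊢
  push_cast at hX hfar ⊢
  constructor
  · linarith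
  · linarith

/-- **`Z₁ ≤ 18·sL`** at the tuple of record (`7P + W + sL + (N+1)R′ + (m₁+m₂+2)R′ ≤ 7(sL+2) + 9sL + 19 + sL + (20K+5)R′ + 242R′`, `40K·R′ ≤ sL + 1`). [this work] -/
theorem Z₁Q_le (κ : Consts) {V : Type} [DecidableEq V] [Countable V] {G : SimpleGraph V} [G.LocallyFinite] (Φ : PlanarSkeletonFrmFrom G) (t : V) (p : unitInterval) (D : Skelφ.StepI.DataNS V) (g : ℕ) (f : ℕ) (mk : ℕ) (hN : EqNumL κ Φ t p D g f) (hg : gFloorKG κ Φ t p D mk ≤ g) (hg2 : 40 * Neg.K κ * KS0.R'0 κ Φ t p D mk ≤ g) :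
    kgZ₁ (nL κ Φ t p D g f) (ℓL κ Φ t p D g f) (hL κ Φ t p D g f) (kgR κ Φ t p D mk) 0 (kgW κ Φ t p D g f (WxQ κ Φ t p D g f))
        (kgNv0 κ Φ t p D g f mk (qxQ κ Φ t p D g f) (WxQ κ Φ t p D g f))
        (kgM₁ (nL κ Φ t p D g f) (ℓL κ Φ t p D g f) (hL κ Φ t p D g f) (kgR κ Φ t p D mk) 0 (kgW κ Φ t p D g f (WxQ κ Φ t p D g f))
          (kgNv0 κ Φ t p D g f mk (qxQ κ Φ t p D g f) (WxQ κ Φ t p D g f)))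
        (kgWm₂ (nL κ Φ t p D g f) (ℓL κ Φ t p D g f) (hL κ Φ t p D g f) (kgR κ Φ t p D mk) 0 (kgW κ Φ t p D g f (WxQ κ Φ t p D g f))
          (kgNv0 κ Φ t p D g f mk (qxQ κ Φ t p D g f) (WxQ κ Φ t p D g f)))
        (kgWp₂ (nL κ Φ t p D g f) (ℓL κ Φ t p D g f) (hL κ Φ t p D g f) (kgR κ Φ t p D mk) 0 (kgW κ Φ t p D g f (WxQ κ Φ t p D g f))
          (kgNv0 κ Φ t p D g f mk (qxQ κ Φ t p D g f) (WxQ κ Φ t p D g f)))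
        (kgM₂ (nL κ Φ t p D g f) (ℓL κ Φ t p D g f) (hL κ Φ t p D g f) (vL κ Φ t p D g f) (kgR κ Φ t p D mk) 0
          (kgq κ Φ t p D g f (qxQ κ Φ t p D g f)) (kgW κ Φ t p D g f (WxQ κ Φ t p D g f)) (kgNv0 κ Φ t p D g f mk (qxQ κ Φ t p D g f) (WxQ κ Φ t p D g f)))
      ≤ 18 * kgSL (nL κ Φ t p D g f) (ℓL κ Φ t p D g f) (hL κ Φ t p D g f) := by
  have H := kgRows0_of κ Φ t p D g f mk (qxQ κ Φ t p D g f) (WxQ κ Φ t p D g f) hN hg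
  have hZ := H.kgZ₁_le (kgNv0 κ Φ t p D g f mk (qxQ κ Φ t p D g f) (WxQ κ Φ t p D g f))
  have ha := m₁Q_le κ Φ t p D g f mk hN hg hg2
  have hb := m₂Q_le κ Φ t p D g f mk hN hg hg2
  obtain ⟨-, hs40, hbig, hR1, hK, -⟩ := valsQ_floor κ Φ t p D g f mk hN hg hg2
  have hNle : ((kgNv0 κ Φ t p D g f mk (qxQ κ Φ t p D g f) (WxQ κ Φ t p D g f) : ℕ) : ℤ) ≤ 20 * (Neg.K κ : ℤ) + 4 := by
    exact_mod_cast kgNv0_le κ Φ t p D g f mk (qxQ κ Φ t p D g f) (WxQ κ Φ t p D g f) hN hg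
  obtain ⟨hW, -⟩ := kgW_WxQ_eq κ Φ t p D g f hN
  have hPd := Skelφ.natDiv_le_kgSLY (one_le_of_eqNumL κ Φ t p D g f hN).1 (ℓL κ Φ t p D g f) (hL κ Φ t p D g f)
  rw [kgSLY_eq_kgSL] at hPd
  rw [hW] at hZ
  unfold kgR at hZ ha hb ⊢
  set s := kgSL (nL κ Φ t p D g f) (ℓL κ Φ t p D g f) (hL κ Φ t p D g f) with hsdef
  set R := ((KS0.R'0 κ Φ t p D mk : ℕ) : ℤ) with hRdef
  set Nn := ((kgNv0 κ Φ t p D g f mk (qxQ κ Φ t p D g f) (WxQ κ Φ t p D g f) : ℕ) : ℤ) with hNn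
  set a := (((kgM₁ (nL κ Φ t p D g f) (ℓL κ Φ t p D g f) (hL κ Φ t p D g f) (KS0.R'0 κ Φ t p D mk) 0 (kgW κ Φ t p D g f (WxQ κ Φ t p D g f))
      (kgNv0 κ Φ t p D g f mk (qxQ κ Φ t p D g f) (WxQ κ Φ t p D g f)) : ℕ) : ℤ)) + 1 with hadef
  set b := (((kgM₂ (nL κ Φ t p D g f) (ℓL κ Φ t p D g f) (hL κ Φ t p D g f) (vL κ Φ t p D g f) (KS0.R'0 κ Φ t p D mk) 0
      (kgq κ Φ t p D g f (qxQ κ Φ t p D g f)) (kgW κ Φ t p D g f (WxQ κ Φ t p D g f)) (kgNv0 κ Φ t p D g f mk (qxQ κ Φ t p D g f) (WxQ κ Φ t p D g f)) : ℕ) : ℤ)) + 1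
    with hbdef
  have ha0 : 0 ≤ a := by positivity
  have hb0 : 0 ≤ b := by positivity
  -- (N+1)R ≤ (20K+5)R ≤ (s+1)/2 + 5R ; (a+b)R ≤ 242 R ; 247 R ≤ s/6
  have h1 : (Nn + 1) * R ≤ (20 * (Neg.K κ : ℤ) + 5) * R := mul_le_mul_of_nonneg_right (by linarith) (by linarith)
  have h2 : (a - 1 + (b - 1) + 2) * (R + ((0 : ℕ) : ℤ)) ≤ 242 * R := by
    push_cast
    have : (a - 1 + (b - 1) + 2) = a + b := by ring
    rw [this]; nlinarith
  push_cast at hZ hPd ⊢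
  nlinarith

/-- **`U·sL ≤ Δ`** (`Δ = modulus n_L h_L v_L v_β > n_Lℓ_L − n_L ≥ sL·U − 1`). [folklore] -/
theorem UsL_le_modulus (κ : Consts) {V : Type} [DecidableEq V] [Countable V] {G : SimpleGraph V} [G.LocallyFinite] (Φ : PlanarSkeletonFrmFrom G) (t : V) (p : unitInterval) (D : Skelφ.StepI.DataNS V) (g : ℕ) (f : ℕ) (hN : EqNumL κ Φ t p D g f) :
    ((shearUnit (nL κ Φ t p D g f) (hL κ Φ t p D g f) : ℕ) : ℤ) * kgSL (nL κ Φ t p D g f) (ℓL κ Φ t p D g f) (hL κ Φ t p D g f) ≤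
      modulus (nL κ Φ t p D g f) (hL κ Φ t p D g f) (vL κ Φ t p D g f) (vβL κ Φ t p D g f) := by
  obtain ⟨hn1, -⟩ := one_le_of_eqNumL κ Φ t p D g f hN
  have hm := (Skelφ.NegPrm.modulus_vβOf hn1 (hL κ Φ t p D g f) (ℓL κ Φ t p D g f) (vL κ Φ t p D g f)).1
  have hvβ : vβL κ Φ t p D g f = Skelφ.NegPrm.vβOf (nL κ Φ t p D g f) (hL κ Φ t p D g f) (ℓL κ Φ t p D g f) (vL κ Φ t p D g f) := rfl
  rw [hvβ]
  have hU : (0 : ℤ) < (shearUnit (nL κ Φ t p D g f) (hL κ Φ t p D g f) : ℕ) := Skelφ.shearUnit_pos hn1 _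
  have hUn : (nL κ Φ t p D g f : ℤ) ≤ (shearUnit (nL κ Φ t p D g f) (hL κ Φ t p D g f) : ℕ) := by
    rw [shearUnit_cast]; linarith [abs_nonneg (hL κ Φ t p D g f)]
  have hfl := Int.ediv_mul_le ((nL κ Φ t p D g f : ℤ) * ℓL κ Φ t p D g f - (shearUnit (nL κ Φ t p D g f) (hL κ Φ t p D g f) : ℕ) + 1) (ne_of_gt hU)
  have e : ((nL κ Φ t p D g f : ℤ) * ℓL κ Φ t p D g f - (shearUnit (nL κ Φ t p D g f) (hL κ Φ t p D g f) : ℕ) + 1) /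
      (shearUnit (nL κ Φ t p D g f) (hL κ Φ t p D g f) : ℕ) = kgSL (nL κ Φ t p D g f) (ℓL κ Φ t p D g f) (hL κ Φ t p D g f) := rfl
  rw [e] at hfl
  linarith

end Vals

end NegB

end PlanarSkeletonFrmFrom

end Summit.CriticalPhenomena.PercolationContinuityZ3.Theorems.Transplant

end
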